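import Literature.Computability.Complexity.HamCircuitNP
import Mathlib.Combinatorics.SimpleGraph.Finite

set_option linter.dupNamespace false

/-!
# Stub T2b `stub_maxDegreeTest` of the line `SketchIdeator1` for crux stmt-PneNP-2717
`Summit.PneNP.PneNP.Theses.PhaseTwins.NoFBPPApproxAboveUniqueness`

The promise "maximum degree `≤ Δ`" of the hard-core counting function is decidable in polynomial
time on graph code words: for every `Δ` there is a `P` language `D` with
`encodingGraph.encode ⟨n, G⟩ ∈ D ↔ G.maxDegree ≤ Δ` (off code words `D` is unconstrained).

The test is assembled in the tree's algebra of `FP` string functions, exactly in the pattern of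
`CliqueNP.codeT` / `CliqueNP.verifT` (`KarpCliqueNP.lean`); no machine is written and no definition
is introduced (the brick pieces are named inside the proof). On a code word
`x = ⟨encodeNat n, adjBits n G⟩` (`HamNP.encode_eq`; `adjBits` the row-major adjacency matrix):

* the yardstick `binToUnaryFn ⟨x, fstF x⟩ = 1ⁿ` (`n ≤ |x|`), which fits (`≤ |u|`) on EVERY input;
* the row piece on `⟨x, 1ⁱ⟩`: the row `(adjBits ↓ i·n) ↾ n` (`umulFn`, `Plumb.dropFn`,
  `Plumb.takeFn`), its pop-count compared with the constant numeral `encodeNat Δ` (`popCountFn`,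
  `Brick.ltFn`, `Brick.notFn`), i.e. the bit `[#1(row i) ≤ Δ]`;
* the index-all fold `Brick.allIdxFn` of the piece over the yardstick: `[∀ i < n, #1(row i) ≤ Δ]`,
  a one-bit `FP` test, hence a `P` language (`CliqueNP.mem_P_of_oneBit`);
* the mathematics: row `i` of `adjBits n G` is the characteristic vector of the neighbours of `i`
  (`take_drop_adjBits`), so its pop-count is `G.degree i` (`CliqueNP.count_true_ofFn`), and
  `G.maxDegree ≤ Δ ↔ ∀ v, G.degree v ≤ Δ` (Mathlib).

## References

* S. Arora, B. Barak, *Computational Complexity: A Modern Approach*, CUP 2009, §0.1 (adjacency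
  matrices), §1.3 (polynomial time is closed under composition and bounded loops).
-/

namespace Summit.PneNP.PneNP.Theorems.NoFBPPApproxAboveUniqueness

open Literature.Computability.Complexity _root_.Computability Polynomial Brick Plumb OracleCompose HashBricks

open scoped Classical in
/-- **Row `i` of the row-major adjacency field** `adjBits n G` (the `n` bits after the first `i n`)
is the characteristic vector of the neighbours of `i`. [folklore] -/
theorem take_drop_adjBits {n : ℕ} (G : SimpleGraph (Fin n)) {i : ℕ} (hi : i < n) :
    ((CliqueNP.adjBits n G).drop (i * n)).take n = List.ofFn fun j : Fin n => decide (G.Adj ⟨i, hi⟩ j) := by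
  refine List.ext_getElem ?_ fun j h1 h2 => ?_
  · have h : (i + 1) * n ≤ n * n := Nat.mul_le_mul_right n hi
    rw [Nat.succ_mul] at h
    simp only [List.length_take, List.length_drop, CliqueNP.length_adjBits, List.length_ofFn]
    omega
  · rw [List.length_ofFn] at h2
    simp only [List.getElem_take, List.getElem_drop, List.getElem_ofFn]
    have e := CliqueNP.getD_adjBits_flat G ⟨i, hi⟩ ⟨j, h2⟩
    rw [List.getD_eq_getElem _ _
      (by rw [CliqueNP.length_adjBits]; exact CliqueNP.flat_lt (⟨i, hi⟩ : Fin n) ⟨j, h2⟩)] at e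
    exact e

open scoped Classical in
/-- **Stub T2b (the degree test).** For every `Δ` there is a `P` language `D` containing exactly those graph
code words `encode ⟨n, G⟩` with `G.maxDegree ≤ Δ` (row pop-counts of the row-major adjacency field compared
with the constant `Δ`, for all `i < n`: `Brick.allIdxFn`, `popCountFn`, `ltFn`). Off code words `D` is
unconstrained. [folklore] -/
theorem stub_maxDegreeTest (Δ : ℕ) :
    ∃ D ∈ Classes.P, ∀ (n : ℕ) (G : SimpleGraph (Fin n)),
      encodingGraph.encode ⟨n, G⟩ ∈ D ↔ G.maxDegree ≤ Δ := by
  -- the brick pieces: the yardstick `1ⁿ` on `x`; on `⟨x, 1ⁱ⟩` the unary dimension, the offset `1^{i n}`,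
  -- the row, the comparison `[Δ < #1(row)]` and its negation; the index-all fold
  set yard : List Bool → List Bool := binToUnaryFn ∘ fanoutFn id fstF with hyard
  set nU : List Bool → List Bool := binToUnaryFn ∘ fanoutFn fstF (fstF ∘ fstF) with hnU
  set offF : List Bool → List Bool := umulFn ∘ fanoutFn sndF nU with hoffF
  set rowF : List Bool → List Bool :=
    takeFn ∘ fanoutFn nU (dropFn ∘ fanoutFn offF (sndF ∘ fstF)) with hrowF
  set cntF : List Bool → List Bool :=
    ltFn ∘ fanoutFn (fun _ => encodeNat Δ) (popCountFn ∘ rowF) with hcntF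
  set piece : List Bool → List Bool := notFn cntF with hpiece
  set T : List Bool → List Bool := allIdxFn yard piece with hT
  -- membership in `FP`, one bit
  have hyardFP : yard ∈ FP := comp_mem_FP binToUnaryFn_mem_FP (fanoutFn_mem_FP id_mem_FP fstF_mem_FP)
  have hnUFP : nU ∈ FP :=
    comp_mem_FP binToUnaryFn_mem_FP (fanoutFn_mem_FP fstF_mem_FP (comp_mem_FP fstF_mem_FP fstF_mem_FP))
  have hoffFP : offF ∈ FP := comp_mem_FP umulFn_mem_FP (fanoutFn_mem_FP sndF_mem_FP hnUFP)
  have hrowFP : rowF ∈ FP :=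
    comp_mem_FP takeFn_mem_FP (fanoutFn_mem_FP hnUFP
      (comp_mem_FP dropFn_mem_FP (fanoutFn_mem_FP hoffFP (comp_mem_FP sndF_mem_FP fstF_mem_FP))))
  have hcntFP : cntF ∈ FP :=
    comp_mem_FP ltFn_mem_FP (fanoutFn_mem_FP (const_mem_FP _) (comp_mem_FP popCountFn_mem_FP hrowFP))
  have hpieceFP : piece ∈ FP := notFn_mem_FP hcntFP
  have h1piece : OneBit piece := oneBit_notFn (oneBit_ltFn.comp _)
  have hyard_le : ∀ u, (yard u).length ≤ u.length := fun u => by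
    simp only [hyard, Function.comp_apply, fanoutFn_apply, id]
    exact length_binToUnaryFn_boolPair_le u (fstF u)
  have hTFP : T ∈ FP := allIdxFn_mem_FP hyardFP hpieceFP h1piece
  have h1T : OneBit T := oneBit_allIdxFn h1piece hyard_le
  refine ⟨{x | T x = [true]}, CliqueNP.mem_P_of_oneBit hTFP h1T, fun n G => ?_⟩
  -- the value of the test on the code word `x = ⟨encodeNat n, adjBits n G⟩` (`n ≤ n² ≤ |x|`)
  have hnx : n ≤ (encodingGraph.encode ⟨n, G⟩).length := by
    rw [HamNP.encode_eq, length_boolPair, CliqueNP.length_adjBits]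
    nlinarith
  set x := encodingGraph.encode ⟨n, G⟩ with hx
  have hfst : fstF x = encodeNat n := by rw [hx, HamNP.encode_eq, fstF_boolPair]
  have hsnd : sndF x = CliqueNP.adjBits n G := by rw [hx, HamNP.encode_eq, sndF_boolPair]
  have hyardx : yard x = ones n := by
    simp only [hyard, Function.comp_apply, fanoutFn_apply, id, hfst, binToUnaryFn_boolPair,
      bitsToNat_encodeNat, min_eq_left hnx]
  have hpiecex : ∀ i : ℕ, piece (boolPair x (ones i)) =
      [decide ((((CliqueNP.adjBits n G).drop (i * n)).take n).count true ≤ Δ)] := by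
    intro i
    have hnUx : nU (boolPair x (ones i)) = ones n := by
      simp only [hnU, Function.comp_apply, fanoutFn_apply, fstF_boolPair, hfst, binToUnaryFn_boolPair,
        bitsToNat_encodeNat, min_eq_left hnx]
    have hoffx : offF (boolPair x (ones i)) = ones (i * n) := by
      simp only [hoffF, Function.comp_apply, fanoutFn_apply, sndF_boolPair, hnUx, umulFn_boolPair]
    have hrowx : rowF (boolPair x (ones i)) = ((CliqueNP.adjBits n G).drop (i * n)).take n := by
      simp only [hrowF, Function.comp_apply, fanoutFn_apply, hnUx, hoffx, fstF_boolPair, hsnd,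
        dropFn_boolPair, takeFn_boolPair, List.length_replicate]
    have hcntx : cntF (boolPair x (ones i)) =
        [decide (Δ < (((CliqueNP.adjBits n G).drop (i * n)).take n).count true)] := by
      simp only [hcntF, Function.comp_apply, fanoutFn_apply, hrowx, popCountFn_apply, ltFn_boolPair,
        bitsToNat_encodeNat]
    rw [hpiece, notFn_apply hcntx]
    simp only [List.cons.injEq, and_true]
    rw [← decide_not]
    exact Bool.decide_congr Nat.not_lt
  have hTx : T x = [decide (∀ i < n, (((CliqueNP.adjBits n G).drop (i * n)).take n).count true ≤ Δ)] := by
    rw [hT, allIdxFn_apply h1piece (hyard_le x), hyardx, List.length_replicate]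
    refine congrArg (fun b => [b]) (Bool.decide_congr ?_)
    simp only [hpiecex, List.cons.injEq, and_true, decide_eq_true_eq]
  -- the mathematics: row pop-counts are degrees
  have hdeg : ∀ (i : ℕ) (hi : i < n),
      (((CliqueNP.adjBits n G).drop (i * n)).take n).count true = G.degree ⟨i, hi⟩ := by
    intro i hi
    rw [take_drop_adjBits G hi, CliqueNP.count_true_ofFn, ← SimpleGraph.card_neighborFinset_eq_degree]
    congr 1
    ext j
    simp
  change T x = [true] ↔ _
  rw [hTx]
  simp only [List.cons.injEq, and_true, decide_eq_true_eq]
  constructor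
  · intro h
    refine SimpleGraph.maxDegree_le_of_forall_degree_le _ _ fun v => ?_
    have hv := h v v.isLt
    rw [hdeg v v.isLt] at hv
    exact hv
  · intro h i hi
    rw [hdeg i hi]
    exact (G.degree_le_maxDegree ⟨i, hi⟩).trans h

end Summit.PneNP.PneNP.Theorems.NoFBPPApproxAboveUniqueness
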